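/-
Copyright (c) 2026 the pub-hodgecm-mathlib formalisation cell (harness21).  Prover seat hodgecm-mathlib-K2Liu-p01 (g8), Track B «K2-LIT»,
#184♮ = hLiu418 = `stmt-HodgeConjecture-24832`; #42S organ S1 ROAD W, F7 ∕ F7r ∕ F8 (RULINGS «M-158a» (2), «M-158b»; LEAD BATCH #8 (4)); SPEC-F7-FrameStep
(ab42186030930277) §2 (ii)∕(iii): the `Δ⁻`-COORDINATE `x ↦ b = halfDiff(eD⁻¹ E′⁻¹ (x, 0))` of ★ (T3a) IS A BIJECTION `Y ≃ (E ⊗ F_v)ⁿ` with explicit inverse — the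
place-generic half `κ₀` of K2Liu-p08 (g4)'s `cells_equiv` letter `κ` (12:24:04Z ∕ 12:25:26Z).
-/
import Literature.NumberTheory.GelbartRogawski1991.LocalDoubledSiegelUnipotentAnisotropy   -- ★ the frame `eD`, `deltaV`, `map_eD_deltaV`, `lagrangianY`, `halfDiff`∕`dblV`∕`adblV`
import HarnessLib

/-!
# Crux `HLiu418`, #42S-S1 ROAD W, file (T3-frame-κ₀): THE `Δ⁻`-COORDINATE OF THE `Y`-MODEL IS A BIJECTION —
# `φ(x) = halfDiff(eD⁻¹ E′⁻¹ (x, 0))`, `ψ(b) = (E′ eD (adblV b)).1`: `φ ∘ ψ = id`, `ψ ∘ φ = id`, `φ` additive, hence `κ₀ : Y ≃+ (E ⊗ F_v)ⁿ`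

Cell `hodgecm-mathlib`, crux item hLiu418 = `stmt-HodgeConjecture-24832` (helper lane `--supports … --as helper`, count-neutral).  THEOREMS ONLY (no `def`, no instance,
no notation, no named-fact hypothesis, no `sorry`).  PLACE-GENERIC: the doubled local currency of ★ `LocalDoubledSiegelUnipotentMover` (`(F, E, c, δ, d, v, n, T₀, JD)`,
ANY mover `E′` with `E′ ℓ_Δ = ℓ_Y`), every `v`.

WHY (SPEC-F7-FrameStep §2 (iii); K2Liu-p08 (g4) ★ p860091 `K2LiuCellCountTransport.natCard_image_mk_preimage_eq (κ : X ≃+ Y)` + ★ p860141 `K2LiuWitnessCellsInertReading`).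
★ (T3a) writes ★ F4a's big-cell integrand through the `Δ⁻`-component `b = φ(x)`; the transport of the COUNT (★ (T3-core), on `b`-coordinates) to the VOLUME (★ (T2), on the
`Y`-model `x`) needs `φ` to be an additive BIJECTION `Y = F_v^{n+n} ≃ (E ⊗ F_v)^n`.  It is, with the EXPLICIT inverse `ψ(b) = (E′(eD(adblV b))).1`:
* `phi_add`, `phi_zero`, `phi_neg` — additivity (★ `halfDiff_add`, linearity of `eD`, `E′`);
* **`phi_psi`** — `φ(ψ b) = b`: `E′⁻¹((E′w).1, 0) = w − E′⁻¹(0, (E′w).2)` with `(0, ·) ∈ ℓ_Y = E′ℓ_Δ`, `ℓ_Δ = eD(Δ)` (★ `map_eD_deltaV`), and `halfDiff(adblV b − dblV a) = b`;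
* **`phi_injective`** — `φ x = 0 ⇒ eD⁻¹E′⁻¹(x,0) ∈ Δ ⇒ (x, 0) ∈ E′ℓ_Δ = ℓ_Y = 0 × Y ⇒ x = 0` (the argument of ★ `dotProduct_cOfFix_mover_conj_eq_zero_iff`, without anisotropy);
* **`psi_phi`**, `phi_bijective`, **`exists_addEquiv`** — `∃ κ₀ : (Fin (n+n) → F_v) ≃+ (Fin n → E ⊗ F_v)` with `κ₀ = φ`, `κ₀⁻¹ = ψ` pointwise (the consumer's `κ` is
  `κ₀` followed by the place reading ★ p860085∕p860045 and, at inert places, the hyperbolic change of basis ★ (ii-a) `K2LiuHyperbolicPairOfIsotropicNorm`).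
[Kudla1994, §3] [HarrisKudlaSweet1996, §1 (1.11)] [MoeglinVignerasWaldspurger1987, Chap. 2 II.1–II.2].
HONEST LABEL.  Count-neutral helper; `HC_CM` is proved only modulo the 7 printed citations (2 remaining named inputs: hLiu418 = `stmt-HodgeConjecture-24832`,
h413 = `stmt-HodgeConjecture-24833`) until rung 0 closes.

## References
* [Kudla1994] S. S. Kudla, *Splitting metaplectic covers of dual reductive pairs*, Israel J. Math. 87 (1994), §3.
* [HarrisKudlaSweet1996] M. Harris, S. S. Kudla, W. J. Sweet, J. Amer. Math. Soc. 9 (1996), §1 (1.11).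
* [MoeglinVignerasWaldspurger1987] C. Mœglin, M.-F. Vignéras, J.-L. Waldspurger, LNM 1291 (1987), Chap. 2 II.1–II.2.
-/

set_option autoImplicit false
set_option linter.dupNamespace false -- the mandated namespace repeats `HodgeConjecture.HodgeConjecture`

noncomputable section

open NumberField IsDedekindDomain Matrix
open Literature.RepresentationTheory.HeisenbergGroup Literature.RepresentationTheory.HeisenbergGroup.SymplecticMatrix
open Literature.NumberTheory.Automorphic Literature.NumberTheory.Automorphic.UnitaryGroup Literature.NumberTheory.Weil1964
open Literature.NumberTheory.GelbartRogawski1991.AdaptedBlocks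
open Literature.NumberTheory.GelbartRogawski1991.UnitaryDualPair Literature.NumberTheory.GelbartRogawski1991.UnitaryDualPair.LocalSplitting

namespace Summit.HodgeConjecture.HodgeConjecture.Cruxes.HLiu418.K2LiuYModelDeltaMinusCoordinate

variable (F : Type) [Field F] [NumberField F] (E : Type) [Field E] [NumberField E] [Algebra F E]
  [Algebra.IsQuadraticExtension F E] (c : E ≃ₐ[F] E)
  {δ : E} (hcδ : c δ = -δ) (hδ : δ ≠ 0) {d : F} (hd : δ * δ = algebraMap F E d)
  (v : HeightOneSpectrum (𝓞 F)) (n : ℕ) {T₀ : Matrix (Fin n) (Fin n) F}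
  (E' : LocalSp F (n + n) (gramD F n T₀) v)

/-! ## §1 Additivity of `φ(x) = halfDiff(eD⁻¹ E′⁻¹ (x, 0))` -/

omit [NumberField F] [Algebra.IsQuadraticExtension F E] in
/-- `dblV (−a) = −dblV a`. [folklore] -/
theorem dblV_neg (a : Fin n → LocalRing E v) : dblV (-a) = -dblV a := by
  funext k; rcases k with i | i <;> simp [dblV]

/-- **`φ` is additive.** [cite: HarrisKudlaSweet1996, §1 (1.11)] -/
theorem phi_add (x y : Fin (n + n) → v.adicCompletion F) :
    halfDiff ((eD F E c hcδ hδ hd v n).symm (toLin F v E'⁻¹ (x + y, 0))) =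
      halfDiff ((eD F E c hcδ hδ hd v n).symm (toLin F v E'⁻¹ (x, 0))) + halfDiff ((eD F E c hcδ hδ hd v n).symm (toLin F v E'⁻¹ (y, 0))) := by
  rw [← halfDiff_add, ← map_add, ← map_add, Prod.mk_add_mk, add_zero]

/-- `φ 0 = 0`. [folklore] -/
theorem phi_zero : halfDiff ((eD F E c hcδ hδ hd v n).symm (toLin F v E'⁻¹ ((0 : Fin (n + n) → v.adicCompletion F), 0))) = 0 := by
  have h := phi_add F E c hcδ hδ hd v n E' 0 0
  rw [add_zero] at h
  exact add_eq_left.1 h.symm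

/-! ## §2 The explicit inverse `ψ(b) = (E′ (eD (adblV b))).1` -/

/-- a vector of `ℓ_Y = 0 × Y` pulls back under `E′` to `eD` of a DIAGONAL vector (`E′ ℓ_Δ = ℓ_Y`, `ℓ_Δ = eD(Δ)`). [cite: Kudla1994, §3] -/
theorem exists_dblV_of_mem_lagrangianY (hE' : (deltaLagrangian F v n).map (toLin F v E') = lagrangianY F (n + n) v)
    (y : Fin (n + n) → v.adicCompletion F) :
    ∃ a : Fin n → LocalRing E v, toLin F v E'⁻¹ (0, y) = eD F E c hcδ hδ hd v n (dblV a) := by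
  have hy : ((0 : Fin (n + n) → v.adicCompletion F), y) ∈ lagrangianY F (n + n) v := by
    rw [lagrangianY, Submodule.mem_prod, Submodule.mem_bot]
    exact ⟨rfl, Submodule.mem_top⟩
  rw [← hE'] at hy
  obtain ⟨w, hw, hwy⟩ := hy
  rw [← map_eD_deltaV F E c hcδ hδ hd v n] at hw
  obtain ⟨u, hu, rfl⟩ := hw
  obtain ⟨a, rfl⟩ := (mem_deltaV_iff_exists F E v n u).1 hu
  refine ⟨a, ?_⟩
  rw [← hwy]
  simp only [LinearEquiv.coe_coe, Subgroup.coe_inv, LinearEquiv.coe_inv, LinearEquiv.symm_apply_apply]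

/-- **`φ(ψ b) = b`.** [cite: Kudla1994, §3] [cite: HarrisKudlaSweet1996, §1 (1.11)] -/
theorem phi_psi (hE' : (deltaLagrangian F v n).map (toLin F v E') = lagrangianY F (n + n) v) (b : Fin n → LocalRing E v) :
    halfDiff ((eD F E c hcδ hδ hd v n).symm (toLin F v E'⁻¹ ((toLin F v E' (eD F E c hcδ hδ hd v n (adblV b))).1, 0))) = b := by
  set w := toLin F v E' (eD F E c hcδ hδ hd v n (adblV b)) with hw
  obtain ⟨a, ha⟩ := exists_dblV_of_mem_lagrangianY F E c hcδ hδ hd v n E' hE' w.2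
  -- `(w.1, 0) = w − (0, w.2)`
  have e : ((w.1, (0 : Fin (n + n) → v.adicCompletion F)) : (Fin (n + n) → v.adicCompletion F) × (Fin (n + n) → v.adicCompletion F)) = w - (0, w.2) := by
    ext <;> simp
  have hinv : toLin F v E'⁻¹ w = eD F E c hcδ hδ hd v n (adblV b) := by
    rw [hw]
    simp only [LinearEquiv.coe_coe, Subgroup.coe_inv, LinearEquiv.coe_inv, LinearEquiv.symm_apply_apply]
  rw [e, map_sub, ha, hinv, ← map_sub, LinearEquiv.symm_apply_apply, sub_eq_add_neg, ← dblV_neg, add_comm, halfDiff_dblV_add_adblV]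

/-! ## §3 Injectivity and the bijection -/

/-- **`φ` is injective**: `φ x = 0 ⇒ x = 0` (`eD⁻¹E′⁻¹(x,0) ∈ Δ ⇒ (x,0) ∈ E′ℓ_Δ = 0 × Y`). [cite: Kudla1994, §3] [cite: MoeglinVignerasWaldspurger1987, Chap. 2 II.1] -/
theorem eq_zero_of_phi_eq_zero (hE' : (deltaLagrangian F v n).map (toLin F v E') = lagrangianY F (n + n) v) {x : Fin (n + n) → v.adicCompletion F}
    (hx : halfDiff ((eD F E c hcδ hδ hd v n).symm (toLin F v E'⁻¹ (x, 0))) = 0) : x = 0 := by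
  set u := (eD F E c hcδ hδ hd v n).symm (toLin F v E'⁻¹ (x, 0)) with hu
  have hu' : u ∈ deltaV F E v n := by
    rw [mem_deltaV_iff_exists]
    exact ⟨halfSum u, by rw [← dblV_halfSum_add_adblV_halfDiff u, hx, adblV_zero, add_zero, halfSum_dblV]⟩
  have hw : toLin F v E'⁻¹ (x, 0) ∈ deltaLagrangian F v n := by
    rw [← map_eD_deltaV F E c hcδ hδ hd v n]
    exact ⟨u, hu', by rw [hu, LinearEquiv.coe_coe, LinearEquiv.apply_symm_apply]⟩
  have hx0 : ((x, (0 : Fin (n + n) → v.adicCompletion F)) : (Fin (n + n) → v.adicCompletion F) × (Fin (n + n) → v.adicCompletion F)) ∈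
      lagrangianY F (n + n) v := by
    rw [← hE']
    refine ⟨toLin F v E'⁻¹ (x, 0), hw, ?_⟩
    simp only [LinearEquiv.coe_coe, Subgroup.coe_inv, LinearEquiv.coe_inv, LinearEquiv.apply_symm_apply]
  rw [lagrangianY, Submodule.mem_prod, Submodule.mem_bot] at hx0
  exact hx0.1

/-- **`φ` is injective.** [cite: Kudla1994, §3] -/
theorem phi_injective (hE' : (deltaLagrangian F v n).map (toLin F v E') = lagrangianY F (n + n) v) :
    Function.Injective fun x : Fin (n + n) → v.adicCompletion F => halfDiff ((eD F E c hcδ hδ hd v n).symm (toLin F v E'⁻¹ (x, 0))) := by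
  intro x y hxy
  have h : halfDiff ((eD F E c hcδ hδ hd v n).symm (toLin F v E'⁻¹ (x - y, 0))) = 0 := by
    have hsub : x - y = x + -y := sub_eq_add_neg x y
    have hneg : halfDiff ((eD F E c hcδ hδ hd v n).symm (toLin F v E'⁻¹ (-y, 0))) = -halfDiff ((eD F E c hcδ hδ hd v n).symm (toLin F v E'⁻¹ (y, 0))) := by
      have h0 := phi_add F E c hcδ hδ hd v n E' y (-y)
      rw [add_neg_cancel, phi_zero] at h0
      exact (neg_eq_of_add_eq_zero_right h0.symm).symm
    simp only at hxy
    rw [hsub, phi_add, hneg, hxy, add_neg_cancel]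
  exact sub_eq_zero.1 (eq_zero_of_phi_eq_zero F E c hcδ hδ hd v n E' hE' h)

/-- **`ψ(φ x) = x`.** [cite: Kudla1994, §3] -/
theorem psi_phi (hE' : (deltaLagrangian F v n).map (toLin F v E') = lagrangianY F (n + n) v) (x : Fin (n + n) → v.adicCompletion F) :
    (toLin F v E' (eD F E c hcδ hδ hd v n (adblV (halfDiff ((eD F E c hcδ hδ hd v n).symm (toLin F v E'⁻¹ (x, 0))))))).1 = x :=
  phi_injective F E c hcδ hδ hd v n E' hE' (phi_psi F E c hcδ hδ hd v n E' hE' _)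

/-- **`φ` is a bijection `F_v^{n+n} → (E ⊗ F_v)^n`.** [cite: Kudla1994, §3] [cite: HarrisKudlaSweet1996, §1 (1.11)] -/
theorem phi_bijective (hE' : (deltaLagrangian F v n).map (toLin F v E') = lagrangianY F (n + n) v) :
    Function.Bijective fun x : Fin (n + n) → v.adicCompletion F => halfDiff ((eD F E c hcδ hδ hd v n).symm (toLin F v E'⁻¹ (x, 0))) :=
  ⟨phi_injective F E c hcδ hδ hd v n E' hE', fun b => ⟨_, phi_psi F E c hcδ hδ hd v n E' hE' b⟩⟩

/-- **THE ADDITIVE EQUIVALENCE `κ₀ : Y ≃+ (E ⊗ F_v)ⁿ`** with `κ₀ = φ` and `κ₀⁻¹ = ψ` pointwise (for ★ `K2LiuCellCountTransport.natCard_image_mk_preimage_eq`).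
[cite: Kudla1994, §3] [cite: HarrisKudlaSweet1996, §1 (1.11)] -/
theorem exists_addEquiv (hE' : (deltaLagrangian F v n).map (toLin F v E') = lagrangianY F (n + n) v) :
    ∃ κ : (Fin (n + n) → v.adicCompletion F) ≃+ (Fin n → LocalRing E v),
      (∀ x, κ x = halfDiff ((eD F E c hcδ hδ hd v n).symm (toLin F v E'⁻¹ (x, 0)))) ∧
      ∀ b, κ.symm b = (toLin F v E' (eD F E c hcδ hδ hd v n (adblV b))).1 := by
  let κ : (Fin (n + n) → v.adicCompletion F) ≃+ (Fin n → LocalRing E v) :=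
    { toFun := fun x => halfDiff ((eD F E c hcδ hδ hd v n).symm (toLin F v E'⁻¹ (x, 0)))
      invFun := fun b => (toLin F v E' (eD F E c hcδ hδ hd v n (adblV b))).1
      left_inv := fun x => psi_phi F E c hcδ hδ hd v n E' hE' x
      right_inv := fun b => phi_psi F E c hcδ hδ hd v n E' hE' b
      map_add' := fun x y => phi_add F E c hcδ hδ hd v n E' x y }
  exact ⟨κ, fun x => rfl, fun b => rfl⟩

end Summit.HodgeConjecture.HodgeConjecture.Cruxes.HLiu418.K2LiuYModelDeltaMinusCoordinate

end
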